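import Summits.CriticalPhenomena.PercolationContinuityZ3.Theorems.Transplant.FKConnectivityAllQAntipodalGadgetLive
import Summits.CriticalPhenomena.PercolationContinuityZ3.Theorems.Transplant.FKConnectivityAllQAntipodalEmbed
import Summits.CriticalPhenomena.PercolationContinuityZ3.Theorems.Transplant.FKConnectivityAllQAntipodalDeletionCells
import Summits.CriticalPhenomena.PercolationContinuityZ3.Theorems.Transplant.FKConnectivityAllQSPNetworks
import Mathlib.Algebra.Order.Archimedean.Basic
import HarnessLib

/-!
# Connectivity correlation inequalities for `φ_{w,q}`, every `q > 0` — file 44a: THE GADGET ITERATION AND THE LIMIT LEMMA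

Support file (`--supports stmt-CriticalPhenomena-4575`), FK sub-lane `prim-bschramm-fk-2` (gen 20); builds on p205010 (kernel theorem,
internal audit signed; external expert review pending).  No definitions, no named facts, no sorries; standard axioms.

* `FK.gadget_limit` — real arithmetic: if `D, L ≤ 0` and `2^k D + ((2+q)^k − 2^k) L + ((2+2q)^k − 2(2+q)^k + 2^k) K ≤ 0` for every `k`, then
  `K ≤ 0` (`0 < q`): divide by `(2+2q)^k` and let `k → ∞` (`exists_pow_lt_of_lt_one`).
* `FK.gadget_iterate` — on a vertex type containing a finite set `S` of vertices isolated from `M ∪ C ∪ {uv}` (and `≠ u, v`), with the gadget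
  live set `M_S = M ∪ ⋃_{m ∈ S} {um, mv}`:  `q^{2|S|}·D(M_S) = 2^{|S|}·D + ((2+q)^{|S|} − 2^{|S|})·L + ((2+2q)^{|S|} − 2(2+q)^{|S|} + 2^{|S|})·K`,
  where `D(X) = apPsiC q X C f g`, `L = apPsiC q (M ∪ {uv}) C f g`, `K = apPsiC q M (C ∪ {uv}) f g` (files 42a/42b, induction on `S`).
* `FK.isTTSP_gadgets` — `E` TTSP with `uv ∈ E` stays TTSP after hanging the 2-paths `u m v`, `m ∈ S` fresh (`FK.IsTTSP.subdivide_parallel`).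
File 44b assembles: U¹¹ in EVERY cell (contracted set of any size) by induction on the size of the contracted set, through `W ⊕ Fin k`.
[cite: Grimmett2006, §1.4 eq. (1.20) (p. 15); §3.8 (pp. 61–62)]
-/

noncomputable section

namespace Summit.CriticalPhenomena.PercolationContinuityZ3.Theorems

namespace FK

open Literature.Probability.LatticeModels Literature.Probability.Percolation
open scoped Classical

/-! ### The limit lemma -/

/-- **The gadget limit** (`0 < q`): from `D, L ≤ 0` and `2^k D + ((2+q)^k − 2^k) L + ((2+2q)^k − 2(2+q)^k + 2^k) K ≤ 0` for all `k`,
conclude `K ≤ 0`. [folklore] -/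
theorem gadget_limit {q D L K : ℝ} (hq : 0 < q) (hD : D ≤ 0) (hL : L ≤ 0)
    (h : ∀ k : ℕ, (2 : ℝ) ^ k * D + ((2 + q) ^ k - 2 ^ k) * L + ((2 + 2 * q) ^ k - 2 * (2 + q) ^ k + 2 ^ k) * K ≤ 0) : K ≤ 0 := by
  by_contra hK
  push Not at hK
  -- r = (2+q)/(2+2q) < 1; pick k with r^k < K / (2K - D - L)
  have hden : 0 < 2 + 2 * q := by linarith
  set r : ℝ := (2 + q) / (2 + 2 * q) with hr
  have hr0 : 0 < r := div_pos (by linarith) hden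
  have hr1 : r < 1 := (div_lt_one hden).2 (by linarith)
  have hS : 0 < 2 * K - D - L := by linarith
  obtain ⟨k, hk⟩ := exists_pow_lt_of_lt_one (div_pos hK hS) hr1
  have hk' : r ^ k * (2 * K - D - L) < K := (lt_div_iff₀ hS).1 hk
  -- compare the k-th inequality, divided by (2+2q)^k, with powers of r
  have hP : 0 < (2 + 2 * q) ^ k := pow_pos hden k
  have h2 : (2 : ℝ) ^ k ≤ (2 + q) ^ k := pow_le_pow_left₀ (by norm_num) (by linarith) k
  have h3 : (2 + q) ^ k = r ^ k * (2 + 2 * q) ^ k := by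
    rw [hr, div_pow, div_mul_cancel₀ _ (ne_of_gt hP)]
  have hk0 := h k
  -- 2^k D ≥ (2+q)^k D,  ((2+q)^k - 2^k) L ≥ (2+q)^k L (both since D, L ≤ 0), and the K-coefficient ≥ (2+2q)^k - 2 (2+q)^k
  have e1 : (2 + q) ^ k * D ≤ (2 : ℝ) ^ k * D := by nlinarith
  have e2 : (2 + q) ^ k * L ≤ ((2 + q) ^ k - 2 ^ k) * L := by nlinarith [pow_nonneg (show (0:ℝ) ≤ 2 by norm_num) k]
  have e3 : ((2 + 2 * q) ^ k - 2 * (2 + q) ^ k) * K ≤ ((2 + 2 * q) ^ k - 2 * (2 + q) ^ k + 2 ^ k) * K := by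
    nlinarith [pow_nonneg (show (0:ℝ) ≤ 2 by norm_num) k]
  have hmain : (2 + 2 * q) ^ k * K ≤ (2 + q) ^ k * (2 * K - D - L) := by nlinarith
  rw [h3] at hmain
  have : K ≤ r ^ k * (2 * K - D - L) := by
    have := div_le_div_of_nonneg_right hmain hP.le
    rwa [mul_comm ((2 + 2 * q) ^ k) K, mul_div_cancel_right₀ _ (ne_of_gt hP), mul_assoc, mul_comm ((2 + 2 * q) ^ k),
      ← mul_assoc, mul_div_cancel_right₀ _ (ne_of_gt hP)] at this
  linarith

/-! ### Iterating the gadget over a set of fresh vertices -/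

section Iterate

variable {U : Type*} [Fintype U] {u v : U} {M C : Finset (Sym2 U)} {q : ℝ} {f g : Finset (Sym2 U) → ℝ}

/-- **The gadget iteration.**  `S` a finite set of vertices, each isolated from `M ∪ C ∪ {uv}` and different from `u, v`; `f, g` not reading
`uv` nor any pair through a vertex of `S`.  With `M_S = M ∪ ⋃_{m∈S} ({um} ∪ {mv})`:
`q^{2|S|}·apPsiC q M_S C f g = 2^{|S|}·D + ((2+q)^{|S|} − 2^{|S|})·L + ((2+2q)^{|S|} − 2(2+q)^{|S|} + 2^{|S|})·K`,
`q^{2|S|}·apPsiC q (M_S ∪ {uv}) C f g = (2+q)^{|S|}·L + 2((2+2q)^{|S|} − (2+q)^{|S|})·K`, `q^{2|S|}·apPsiC q M_S (C ∪ {uv}) f g = (2+2q)^{|S|}·K`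
(`D = apPsiC q M C f g`, `L = apPsiC q (M ∪ {uv}) C f g`, `K = apPsiC q M (C ∪ {uv}) f g`). [cite: Grimmett2006, §1.4 eq. (1.20) (p. 15)] -/
theorem gadget_iterate (huv : u ≠ v) (heM : s(u, v) ∉ M)
    (hfe : ∀ A : Finset (Sym2 U), f (insert s(u, v) A) = f A) (hge : ∀ A : Finset (Sym2 U), g (insert s(u, v) A) = g A)
    (S : Finset U) (hSu : u ∉ S) (hSv : v ∉ S) (hSM : ∀ m ∈ S, ∀ e ∈ M, m ∉ e) (hSC : ∀ m ∈ S, ∀ e ∈ C, m ∉ e)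
    (hfS : ∀ m ∈ S, ∀ w : U, ∀ A : Finset (Sym2 U), f (insert s(m, w) A) = f A)
    (hgS : ∀ m ∈ S, ∀ w : U, ∀ A : Finset (Sym2 U), g (insert s(m, w) A) = g A) :
    q ^ (2 * S.card) * apPsiC q (M ∪ S.biUnion fun m => {s(u, m)} ∪ {s(m, v)}) C f g =
        (2 : ℝ) ^ S.card * apPsiC q M C f g + ((2 + q) ^ S.card - 2 ^ S.card) * apPsiC q (insert s(u, v) M) C f g +
          ((2 + 2 * q) ^ S.card - 2 * (2 + q) ^ S.card + 2 ^ S.card) * apPsiC q M (insert s(u, v) C) f g ∧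
      q ^ (2 * S.card) * apPsiC q (insert s(u, v) (M ∪ S.biUnion fun m => {s(u, m)} ∪ {s(m, v)})) C f g =
        (2 + q) ^ S.card * apPsiC q (insert s(u, v) M) C f g +
          2 * ((2 + 2 * q) ^ S.card - (2 + q) ^ S.card) * apPsiC q M (insert s(u, v) C) f g ∧
      q ^ (2 * S.card) * apPsiC q (M ∪ S.biUnion fun m => {s(u, m)} ∪ {s(m, v)}) (insert s(u, v) C) f g =
        (2 + 2 * q) ^ S.card * apPsiC q M (insert s(u, v) C) f g := by
  induction S using Finset.induction_on with
  | empty =>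
    simp only [Finset.biUnion_empty, Finset.union_empty, Finset.card_empty, Nat.mul_zero, pow_zero, one_mul]
    exact ⟨by ring, by ring, trivial⟩
  | @insert m S hmS ih =>
    have hSu' : u ∉ S := fun h => hSu (Finset.mem_insert_of_mem h)
    have hSv' : v ∉ S := fun h => hSv (Finset.mem_insert_of_mem h)
    obtain ⟨ihD, ihL, ihK⟩ := ih hSu' hSv' (fun m' hm' => hSM m' (Finset.mem_insert_of_mem hm'))
      (fun m' hm' => hSC m' (Finset.mem_insert_of_mem hm')) (fun m' hm' => hfS m' (Finset.mem_insert_of_mem hm'))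
      (fun m' hm' => hgS m' (Finset.mem_insert_of_mem hm'))
    have hum : u ≠ m := fun h => hSu (h ▸ Finset.mem_insert_self _ _)
    have hvm : v ≠ m := fun h => hSv (h ▸ Finset.mem_insert_self _ _)
    set MS := M ∪ S.biUnion (fun m => {s(u, m)} ∪ {s(m, v)}) with hMS
    have hstep : (M ∪ (insert m S).biUnion fun m => {s(u, m)} ∪ {s(m, v)}) = insert s(u, m) (insert s(m, v) MS) := by
      rw [Finset.biUnion_insert, ← Finset.union_assoc, Finset.union_comm M, Finset.union_assoc, ← hMS, Finset.union_assoc,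
        ← Finset.insert_eq, ← Finset.insert_eq]
    -- m is isolated from MS, C, and uv ∉ MS
    have hmM : ∀ e ∈ MS, m ∉ e := by
      intro e he hme
      rcases Finset.mem_union.1 he with h | h
      · exact hSM m (Finset.mem_insert_self _ _) e h hme
      · rw [Finset.mem_biUnion] at h
        obtain ⟨m', hm', h⟩ := h
        have hmm' : m ≠ m' := fun hh => hmS (hh ▸ hm')
        simp only [Finset.mem_union, Finset.mem_singleton] at h
        rcases h with rfl | rfl
        · rcases Sym2.mem_iff.1 hme with h | h
          · exact hum h.symm
          · exact hmm' h
        · rcases Sym2.mem_iff.1 hme with h | h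
          · exact hmm' h
          · exact hvm h.symm
    have hmC : ∀ e ∈ C, m ∉ e := hSC m (Finset.mem_insert_self _ _)
    have heMS : s(u, v) ∉ MS := by
      intro he
      rcases Finset.mem_union.1 he with h | h
      · exact heM h
      · rw [Finset.mem_biUnion] at h
        obtain ⟨m', hm', h⟩ := h
        simp only [Finset.mem_union, Finset.mem_singleton] at h
        have hm'u : m' ≠ u := fun hh => hSu' (hh ▸ hm')
        have hm'v : m' ≠ v := fun hh => hSv' (hh ▸ hm')
        rcases h with h | h
        · rw [Sym2.eq_iff] at h
          rcases h with ⟨_, h2⟩ | ⟨h1, _⟩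
          · exact hm'v h2.symm
          · exact hm'u h1.symm
        · rw [Sym2.eq_iff] at h
          rcases h with ⟨h1, _⟩ | ⟨h1, _⟩
          · exact hm'u h1.symm
          · exact huv h1
    have hfa := hfS m (Finset.mem_insert_self _ _) u
    have hfb := hfS m (Finset.mem_insert_self _ _) v
    have hga := hgS m (Finset.mem_insert_self _ _) u
    have hgb := hgS m (Finset.mem_insert_self _ _) v
    have hfa' : ∀ A : Finset (Sym2 U), f (insert s(u, m) A) = f A := fun A => by rw [Sym2.eq_swap]; exact hfa A
    have hga' : ∀ A : Finset (Sym2 U), g (insert s(u, m) A) = g A := fun A => by rw [Sym2.eq_swap]; exact hga A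
    have cD := gadget_delete_eq (M := MS) (C := C) (q := q) huv hum hvm hmM hmC heMS hfe hfa' hfb hge hga' hgb
    have cL := gadget_live_eq (M := MS) (C := C) (q := q) huv hum hvm hmM hmC heMS hfe hfa' hfb hge hga' hgb
    have cK := gadget_contract_eq (M := MS) (C := C) (q := q) huv hum hvm hmM hmC hfa' hfb hga' hgb
    rw [hstep, Finset.card_insert_of_notMem hmS]
    have hpow : q ^ (2 * (S.card + 1)) = q ^ (2 * S.card) * q ^ 2 := by ring
    refine ⟨?_, ?_, ?_⟩
    · calc q ^ (2 * (S.card + 1)) * apPsiC q (insert s(u, m) (insert s(m, v) MS)) C f g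
          = q ^ (2 * S.card) * (q ^ 2 * apPsiC q (insert s(u, m) (insert s(m, v) MS)) C f g) := by rw [hpow]; ring
        _ = q ^ (2 * S.card) * (2 * apPsiC q MS C f g + q * apPsiC q (insert s(u, v) MS) C f g) := by rw [cD]
        _ = 2 * (q ^ (2 * S.card) * apPsiC q MS C f g) + q * (q ^ (2 * S.card) * apPsiC q (insert s(u, v) MS) C f g) := by ring
        _ = _ := by rw [ihD, ihL]; ring
    · calc q ^ (2 * (S.card + 1)) * apPsiC q (insert s(u, v) (insert s(u, m) (insert s(m, v) MS))) C f g
          = q ^ (2 * S.card) * (q ^ 2 * apPsiC q (insert s(u, v) (insert s(u, m) (insert s(m, v) MS))) C f g) := by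
            rw [hpow]; ring
        _ = q ^ (2 * S.card) * ((2 + q) * apPsiC q (insert s(u, v) MS) C f g + 2 * q * apPsiC q MS (insert s(u, v) C) f g) := by
            rw [cL]
        _ = (2 + q) * (q ^ (2 * S.card) * apPsiC q (insert s(u, v) MS) C f g) +
              2 * q * (q ^ (2 * S.card) * apPsiC q MS (insert s(u, v) C) f g) := by ring
        _ = _ := by rw [ihL, ihK]; ring
    · calc q ^ (2 * (S.card + 1)) * apPsiC q (insert s(u, m) (insert s(m, v) MS)) (insert s(u, v) C) f g
          = q ^ (2 * S.card) * (q ^ 2 * apPsiC q (insert s(u, m) (insert s(m, v) MS)) (insert s(u, v) C) f g) := by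
            rw [hpow]; ring
        _ = q ^ (2 * S.card) * ((2 + 2 * q) * apPsiC q MS (insert s(u, v) C) f g) := by rw [cK]
        _ = (2 + 2 * q) * (q ^ (2 * S.card) * apPsiC q MS (insert s(u, v) C) f g) := by ring
        _ = _ := by rw [ihK]; ring

omit [Fintype U] in
/-- **The gadget host is two-terminal series–parallel**: hanging a 2-path `u m v` at each fresh `m ∈ S` on a TTSP network containing `uv`.
[folklore] -/
theorem isTTSP_gadgets {E : Finset (Sym2 U)} {s t : U} (hE : IsTTSP E s t) (he : s(u, v) ∈ E) (S : Finset U)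
    (hSu : u ∉ S) (hSv : v ∉ S) (hSE : ∀ m ∈ S, ∀ e ∈ E, m ∉ e) :
    IsTTSP (E ∪ S.biUnion fun m => {s(u, m)} ∪ {s(m, v)}) s t := by
  induction S using Finset.induction_on with
  | empty => simpa using hE
  | @insert m S hmS ih =>
    have ih' := ih (fun h => hSu (Finset.mem_insert_of_mem h)) (fun h => hSv (Finset.mem_insert_of_mem h))
      (fun m' hm' => hSE m' (Finset.mem_insert_of_mem hm'))
    have hum : u ≠ m := fun h => hSu (h ▸ Finset.mem_insert_self _ _)
    have hvm : v ≠ m := fun h => hSv (h ▸ Finset.mem_insert_self _ _)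
    have hfresh : ∀ e ∈ E ∪ S.biUnion (fun m => {s(u, m)} ∪ {s(m, v)}), m ∉ e := by
      intro e he hme
      rcases Finset.mem_union.1 he with h | h
      · exact hSE m (Finset.mem_insert_self _ _) e h hme
      · rw [Finset.mem_biUnion] at h
        obtain ⟨m', hm', h⟩ := h
        have hmm' : m ≠ m' := fun hh => hmS (hh ▸ hm')
        simp only [Finset.mem_union, Finset.mem_singleton] at h
        rcases h with rfl | rfl
        · rcases Sym2.mem_iff.1 hme with h | h
          · exact hum h.symm
          · exact hmm' h
        · rcases Sym2.mem_iff.1 hme with h | h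
          · exact hmm' h
          · exact hvm h.symm
    have key := ih'.subdivide_parallel (Finset.mem_union_left _ he) hfresh
    have hset : (E ∪ (insert m S).biUnion fun m => {s(u, m)} ∪ {s(m, v)}) =
        (E ∪ S.biUnion fun m => {s(u, m)} ∪ {s(m, v)}) ∪ ({s(u, m)} ∪ {s(m, v)}) := by
      rw [Finset.biUnion_insert, ← Finset.union_assoc, Finset.union_right_comm]
    rw [hset]
    exact key

end Iterate

end FK

end Summit.CriticalPhenomena.PercolationContinuityZ3.Theorems

end
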